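import Literature.NumberTheory.EllipticCurves.Greenberg1999.KummerImageGoodOrdinaryNumberField
import Literature.NumberTheory.EllipticCurves.LocalPointsOrdinaryKummerCongruenceProofs
import Literature.NumberTheory.EllipticCurves.LocalPointsOrdinaryKernelDivisibleProofs
import Literature.NumberTheory.EllipticCurves.HasseWeilGoodReductionFrobeniusProofs
import Literature.NumberTheory.EllipticCurves.SubgroupSelmerCocycleCriteriaProofs
import Literature.NumberTheory.EllipticCurves.NeronOggShafarevichLocal
import Literature.NumberTheory.EllipticCurves.GeomPointsGaloisModule
import Literature.NumberTheory.GaloisRepresentations.AbsGaloisGroupCompact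
import Mathlib.Data.Nat.Factorization.Basic
import HarnessLib

/-!
# Kummer classes are STRICT at a place `v ∣ p` of good ordinary reduction, for Greenberg's canonical datum
# `C_v = E[p^∞] ∩ E₁(K̄_v)` — `Im(κ_L) ⊆ Im(λ_L)`, Greenberg LNM 1716 §2 Prop. 2.2 (i) (theorems only)

`Proofs` file (THEOREMS ONLY: no definition, no named fact, no instance, no `sorry`) in topic
`NumberTheory/EllipticCurves` (cell `pub/bsd-print-x9`, road CG-FRAME letter (A); `--supports` the shared μ-item
stmt-BirchSwinnertonDyer-23237 `MuInequalityCoherentPairOfPrint`). Vocabulary of `SubgroupSelmer` / `GreenbergSelmer` /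
`Greenberg1999/KummerImageGoodOrdinaryNumberField`: `K` a number field, `E = W` elliptic over `K`, `p` prime, `v ∋ p` a place
of GOOD ORDINARY reduction (`W.HasGoodReductionAt v`, `p ∤ a_v`), `K_v = v.adicCompletion K`, `E(K̄_v) = localPoints W K_v`,
`E₁ = E₁(K̄_v) = W.localKernelOfReduction v` (the kernel of reduction, Greenberg's `𝓕(𝔪̄)`), and for ANY subgroup
`H ≤ Γ_K` (fixed field `L`): the Kummer local condition `W.localKerOver p H K_v` (classes of `H¹(H, E[p^∞])` dying in
`H¹(H_{K_v}, E(K̄_v))`, i.e. in `Im κ_{L_w}`) and the STRICT condition `(W.kernelOfReductionLocalDatum p v).strictKer H`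
(classes dying in `H¹(H ⊓ D_v, E[p^∞] ⧸ C_v)`, `C_v = E[p^∞] ∩ E₁(K̄_v)` Greenberg's canonical datum, i.e. in `Im λ_{L_w}`).

* §1 `AddSubgroup.exists_nsmul_mem_of_finset_cosets` — pigeonhole: a subgroup meeting finitely many `E₁`-cosets is torsion
  modulo `E₁`.
* §2 `WeierstrassCurve.exists_nsmul_mem_localKernelOfReduction` — **`E(K̄_v) ⧸ E₁(K̄_v) = Ẽ(k̄_v)` is a torsion group at a
  place of good reduction**: every `P ∈ E(K̄_v)` has `n • P ∈ E₁` for some `n ≥ 1` (the open stabiliser of `P` contains a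
  power `σ₀^{N₀}` of a Frobenius, and the points with `σ₀^{N₀} R ≡ R (mod E₁)` lie in finitely many `E₁`-cosets, tree
  `exists_finset_sub_mem_localKernelOfReduction_of_isArithFrobAt_pow` — "`Ẽ(𝔽_{q^{N₀}})` is finite").
* §3 **`WeierstrassCurve.localKerOver_le_strictKer_kernelOfReduction`** — `Im κ ⊆ Im λ` pulled back to `H¹(H, E[p^∞])`:
  `W.localKerOver p H K_v ≤ (W.kernelOfReductionLocalDatum p v).strictKer H` for EVERY `H ≤ Γ_K` (no closedness, no
  `ℤ_p`-tower, no frame hypothesis).  Greenberg's proof of Prop. 2.2 (i) ("`Ẽ(m) ⊗ ℚ_p/ℤ_p = 0`", p. 73): the Kummer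
  witness `P ∈ E(K̄_v)` of a class (`τ P − P = ι f(τ)` on `H_{K_v}`) has finite order `n = p^c u`, `p ∤ u`, modulo `E₁` (§2);
  Bézout splits `P = P' + P_p` with `u P' ∈ E₁`, `p^c P_p ∈ E₁`; the cocycle is `p`-primary, so `τ P' − P' ∈ E₁`
  (killed by `p^k` and by `u` modulo `E₁`); `p^c P_p = p^c Z` with `Z ∈ E₁` (`E₁` is `p`-divisible at good ORDINARY `v ∣ p`,
  tree `exists_pow_nsmul_eq_of_mem_localKernelOfReduction_of_ordinary`), so `q₀ = P_p − Z` is a TORSION point, hence comes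
  from `E[p^∞](K̄)` (`exists_pointsMapOfEmb_eq_of_nsmul_eq_zero`), and `f(y) ≡ y q₀ − q₀ (mod C_v)` on `H ⊓ D_v` — the class
  is strict.  This is the `≤` half of the equation `localKerOver = strictKer` recorded (cite-only, general towers) as
  `Greenberg1999.imKummer_eq_strictCondition_goodOrdinary_numberField`; it is NOT the inertia-form statement
  `localKerOver ≤ greenbergKer` of `X2/GreenbergVatsalSelmerLink` (the strict condition restricts to the DECOMPOSITION group,
  where Kummer compatibility on inertia is not enough).
* §4 corollaries at `H = ker κ` for a `ℤ_p`-extension `κ` (the shape the cell's consumers read, `…kerSubgroup_kernelOfReduction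
  … .le` in `ZpExtensionEisensteinReadoutOrdinaryPrincipalProofs` §3) and the equation from the converse half.

HONEST FRAMING: the EASY direction of Greenberg's Prop. 2.4 only (`Im κ ⊆ Im λ`); the converse `Im λ ⊆ Im κ` (Tate / Coates–
Greenberg, `H¹(L, 𝓕(𝔪̄)) = 0` for deeply ramified `L`) is NOT proved here. No summit statement is proved; BSD is not proved by
any of this.

References: [GreenbergLNM1716] R. Greenberg, *Iwasawa theory for elliptic curves*, LNM 1716 (1999), §2 Prop. 2.2 and its proof
(p. 73: `C_v = 𝓕(𝔪̄)[p^∞]`, "`Im(κ_η) ⊆ … which coincides with Im(λ_η)`", "`Ẽ(m)` is a torsion group"), Prop. 2.4 (pp. 79–80);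
[Greenberg1989] R. Greenberg, Adv. Stud. Pure Math. 17 (1989) §1 p. 98 (the strict condition); [SilvermanAEC2009] VII.2.1–2.2
(`E₁`, reduction), VIII §1, Cor. III.6.4.
-/

noncomputable section

open scoped Classical NNReal

/-! ## §1 Pigeonhole: a subgroup meeting finitely many `E₁`-cosets is torsion modulo `E₁` -/

namespace AddSubgroup

variable {G : Type*} [AddCommGroup G]

/-- **Pigeonhole modulo `E₁`.** If every element of a subgroup `Q` is congruent modulo the subgroup `E₁` to a member of a finite
set `T`, then every `R ∈ Q` has `n • R ∈ E₁` for some `0 < n` (`≤ #T`): among `1•R, …, (#T+1)•R ∈ Q` two share their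
`T`-representative. [cite: GreenbergLNM1716, §2 Prop. 2.2 (p. 73: Ẽ(m) is a torsion group)] -/
theorem exists_nsmul_mem_of_finset_cosets (E₁ Q : AddSubgroup G) (T : Finset G)
    (hT : ∀ R ∈ Q, ∃ t ∈ T, R - t ∈ E₁) {R : G} (hR : R ∈ Q) :
    ∃ n : ℕ, 0 < n ∧ n • R ∈ E₁ := by
  classical
  -- representatives `t i ∈ T` of `i • R`, `i = 0, …, #T`
  have hrep : ∀ i : ℕ, ∃ t ∈ T, i • R - t ∈ E₁ := fun i ↦ hT _ (Q.nsmul_mem hR i)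
  choose t htT ht using hrep
  obtain ⟨i, hi, j, hj, hij, htij⟩ := Finset.exists_ne_map_eq_of_card_lt_of_maps_to
    (s := Finset.range (T.card + 1)) (t := T) (f := t) (by simp) (fun i _ ↦ htT i)
  -- `(i - j) • R ∈ E₁` for the larger of the two indices
  wlog hlt : j < i generalizing i j
  · exact this j hj i hi hij.symm htij.symm (lt_of_le_of_ne (not_lt.mp hlt) hij)
  refine ⟨i - j, Nat.sub_pos_of_lt hlt, ?_⟩
  have h : (i - j) • R = (i • R - t i) - (j • R - t j) := by
    rw [htij, sub_sub_sub_cancel_right, eq_sub_iff_add_eq, ← add_nsmul, Nat.sub_add_cancel hlt.le]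
  rw [h]
  exact E₁.sub_mem (ht i) (ht j)

end AddSubgroup

/-! ## §2 `E(K̄_v) ⧸ E₁(K̄_v)` is torsion at a place of good reduction -/

namespace WeierstrassCurve

open NumberField IsDedekindDomain Field Literature.NumberTheory.EllipticCurves
  Literature.NumberTheory.GaloisRepresentations IsDedekindDomain.HeightOneSpectrum
  Literature.NumberTheory.EllipticCurves.GreenbergSelmer

variable {K : Type} [Field K] [NumberField K] (W : WeierstrassCurve K) (v : HeightOneSpectrum (𝓞 K))

/-- **`Ẽ(k̄_v)` is a torsion group, on `E(K̄_v)`**: at a place `v` of good reduction every `P ∈ E(K̄_v)` has `n • P ∈ E₁(K̄_v)`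
for some `0 < n`.  Proof: the stabiliser of `P` in `Γ_{K_v}` is open (`isOpen_stabilizer_localPoints`), hence of finite index
(`Γ_{K_v}` compact), so it contains `σ₀^{N₀}`, `0 < N₀`, for an arithmetic Frobenius `σ₀` (`exists_isArithFrobAt_localAbsIntegers`);
the subgroup `{R | σ₀^{N₀} R ≡ R (mod E₁)} ∋ P` meets finitely many `E₁`-cosets
(`exists_finset_sub_mem_localKernelOfReduction_of_isArithFrobAt_pow`: reductions in `Ẽ(𝔽_{q^{N₀}})`); pigeonhole (§1).
[cite: GreenbergLNM1716, §2 Props. 2.1–2.2 (pp. 70–73: Ẽ of the residue field is finite / torsion)]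
[cite: SilvermanAEC2009, Prop. VII.2.1] -/
theorem exists_nsmul_mem_localKernelOfReduction [W.IsElliptic] (hgood : W.HasGoodReductionAt v)
    (P : localPoints W (v.adicCompletion K)) :
    ∃ n : ℕ, 0 < n ∧ n • P ∈ W.localKernelOfReduction v := by
  classical
  obtain ⟨𝔐, h𝔐⟩ := v.localPrimesAbove_nonempty
  obtain ⟨σ₀, hσ₀⟩ := IsDedekindDomain.HeightOneSpectrum.exists_isArithFrobAt_localAbsIntegers v h𝔐
  -- the open stabiliser of `P` has finite index in the compact group `Γ_{K_v}`: it contains a power of `σ₀`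
  haveI : CompactSpace (absoluteGaloisGroup (v.adicCompletion K)) := absoluteGaloisGroup_compactSpace _
  set U : Subgroup (absoluteGaloisGroup (v.adicCompletion K)) := MulAction.stabilizer _ P with hU
  have hUo : IsOpen (U : Set (absoluteGaloisGroup (v.adicCompletion K))) :=
    W.isOpen_stabilizer_localPoints (v.adicCompletion K) P
  haveI : Finite (absoluteGaloisGroup (v.adicCompletion K) ⧸ U) := Subgroup.quotient_finite_of_isOpen U hUo
  obtain ⟨N₀, hN₀, -, hσU⟩ :=
    Subgroup.exists_pow_mem_of_index_ne_zero (H := U) (Subgroup.index_ne_zero_iff_finite.mpr ‹_›) σ₀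
  have hfix : σ₀ ^ N₀ • P = P := MulAction.mem_stabilizer_iff.mp hσU
  -- the finitely many `E₁`-cosets of the points whose reduction is fixed by `Frob^{N₀}`
  obtain ⟨T, hT⟩ := W.exists_finset_sub_mem_localKernelOfReduction_of_isArithFrobAt_pow hgood h𝔐 hσ₀ hN₀
  let Q : AddSubgroup (localPoints W (v.adicCompletion K)) :=
    { carrier := {R | σ₀ ^ N₀ • R - R ∈ W.localKernelOfReduction v}
      add_mem' := fun {a b} ha hb ↦ by
        simp only [Set.mem_setOf_eq] at ha hb ⊢
        rw [smul_add, add_sub_add_comm]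
        exact add_mem ha hb
      zero_mem' := by
        simp only [Set.mem_setOf_eq, smul_zero, sub_zero]
        exact zero_mem _
      neg_mem' := fun {a} ha ↦ by
        simp only [Set.mem_setOf_eq] at ha ⊢
        rw [smul_neg, neg_sub_neg, ← neg_sub]
        exact neg_mem ha }
  have hPQ : P ∈ Q := by
    change σ₀ ^ N₀ • P - P ∈ W.localKernelOfReduction v
    rw [hfix, sub_self]
    exact zero_mem _
  exact AddSubgroup.exists_nsmul_mem_of_finset_cosets (W.localKernelOfReduction v) Q T (fun R hR ↦ hT R hR) hPQ

/-! ## §3 Kummer ⇒ strict for the canonical datum (Greenberg Prop. 2.2 (i)) -/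

variable (p : ℕ) [hp : Fact p.Prime] (H : Subgroup (absoluteGaloisGroup K))

/-- Bézout bookkeeping in a `Γ`-module modulo a stable subgroup: if `D` is killed by `p^k` and `u • D ∈ E₁` with `p ∤ u`… in the
form used below — **a `p`-primary element whose `u`-multiple lies in `E₁`, `u` prime to `p`, lies in `E₁`**.
[cite: GreenbergLNM1716, §2 proof of Prop. 2.2 (p. 73)] -/
theorem mem_of_pow_nsmul_eq_zero_of_nsmul_mem {M : Type*} [AddCommGroup M] (E₁ : AddSubgroup M) {p u k : ℕ}
    (hpu : Nat.Coprime (p ^ k) u) {D : M} (hk : p ^ k • D = 0) (hu : u • D ∈ E₁) : D ∈ E₁ := by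
  obtain ⟨a, b, hab⟩ := Nat.isCoprime_iff_coprime.mpr hpu
  have h : D = (b : ℤ) • (u • D) := by
    conv_lhs => rw [← one_zsmul D, ← hab]
    rw [add_zsmul, mul_zsmul, mul_zsmul, natCast_zsmul, natCast_zsmul, hk, zsmul_zero, zero_add]
  rw [h]
  exact E₁.zsmul_mem hu _

/-- **Kummer classes are strict (`Im κ_{L_w} ⊆ Im λ_{L_w}`), for the canonical datum `C_v = E[p^∞] ∩ E₁(K̄_v)` at a place
`v ∣ p` of good ordinary reduction** — Greenberg LNM 1716 §2 Prop. 2.2 (i), pulled back to `H¹(H, E[p^∞])` for ANY subgroup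
`H ≤ Γ_K`: `W.localKerOver p H K_v ≤ (W.kernelOfReductionLocalDatum p v).strictKer H`.  (Ordinarity in the form `p ∤ a_v`;
proof in the module docstring.) [cite: GreenbergLNM1716, §2 Prop. 2.2 (i) and its proof (p. 73), Prop. 2.4 (pp. 79–80)]
[cite: Greenberg1989, §1 p. 98 (strict condition)] [cite: SilvermanAEC2009, Props. VII.2.1–2.2 and Cor. III.6.4] -/
theorem localKerOver_le_strictKer_kernelOfReduction_of_not_dvd [W.IsElliptic]
    (hpv : (p : 𝓞 K) ∈ v.asIdeal) (hgood : W.HasGoodReductionAt v) (hord : ¬ ((p : ℤ) ∣ W.frobeniusTraceAt v)) :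
    W.localKerOver p H (v.adicCompletion K) ≤ (W.kernelOfReductionLocalDatum p v).strictKer H := by
  classical
  haveI : CharZero K := inferInstance
  intro c hc
  obtain ⟨f, rfl⟩ := oneCocycleClass_surjective (discreteTopRep H (W.geomPrimaryTorsion p)) c
  -- the Kummer witness `P ∈ E(K̄_v)`: `ι f(res τ) = τ • P - P` on `H_{K_v}`
  rw [WeierstrassCurve.mem_localKerOver_iff] at hc
  unfold WeierstrassCurve.localResOver WeierstrassCurve.localResOverOfEmb at hc
  obtain ⟨P, hP⟩ := (CocycleCriteria.resH1Hom_oneCocycleClass_eq_zero_iff _ _ _ f).mp hc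
  -- notation
  set Kv := v.adicCompletion K with hKv
  set E₁ := W.localKernelOfReduction v with hE₁
  set N := W.kernelOfReductionLocalDatum p v with hN
  -- `P` has finite order `n = p^c₀ · u` modulo `E₁`
  obtain ⟨n, hn, hnP⟩ := W.exists_nsmul_mem_localKernelOfReduction v hgood P
  set c₀ := n.factorization p with hc₀
  set u := n / p ^ c₀ with hu
  have hn_eq : p ^ c₀ * u = n := Nat.ordProj_mul_ordCompl_eq_self n p
  have hcop : Nat.Coprime p u := Nat.coprime_ordCompl hp.out hn.ne'
  obtain ⟨α, β, hαβ⟩ := Nat.isCoprime_iff_coprime.mpr (hcop.pow_left c₀)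
  -- Bézout splitting `P = P' + Pp`
  set P' : localPoints W Kv := (α * (p ^ c₀ : ℕ)) • P with hP'
  set Pp : localPoints W Kv := (β * (u : ℕ)) • P with hPp
  have hsplit : P = P' + Pp := by
    rw [hP', hPp, ← add_zsmul, hαβ, one_zsmul]
  -- `u • P' ∈ E₁` and `p^c₀ • Pp ∈ E₁`
  have huP' : u • P' ∈ E₁ := by
    have h : u • P' = α • (n • P) := by
      rw [hP', ← natCast_zsmul, smul_smul, ← natCast_zsmul P n, smul_smul, ← hn_eq]
      push_cast
      ring_nf
    rw [h]
    exact E₁.zsmul_mem hnP α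
  have hpPp : p ^ c₀ • Pp ∈ E₁ := by
    have h : p ^ c₀ • Pp = β • (n • P) := by
      rw [hPp, ← natCast_zsmul, smul_smul, ← natCast_zsmul P n, smul_smul, ← hn_eq]
      push_cast
      ring_nf
    rw [h]
    exact E₁.zsmul_mem hnP β
  -- divide in `E₁` (good ORDINARY reduction): `p^c₀ • Z = p^c₀ • Pp`, and the torsion point `q₀ = Pp - Z`
  obtain ⟨Z, hZ, hZeq⟩ := W.exists_pow_nsmul_eq_of_mem_localKernelOfReduction_of_ordinary hpv hgood hord c₀ hpPp
  set q₀ : localPoints W Kv := Pp - Z with hq₀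
  have hq₀tors : p ^ c₀ • q₀ = 0 := by rw [hq₀, smul_sub, hZeq, sub_self]
  obtain ⟨Q₀, hQ₀tors, hQ₀⟩ := exists_pointsMapOfEmb_eq_of_nsmul_eq_zero W (closureEmb (K := K) Kv)
    (m := p ^ c₀) (pow_ne_zero _ hp.out.ne_zero) hq₀tors
  have hQ₀mem : Q₀ ∈ W.geomPrimaryTorsion p := (AddCommGroup.mem_primaryComponent).mpr ⟨c₀, hQ₀tors⟩
  set Q₁ : W.geomPrimaryTorsion p := ⟨Q₀, hQ₀mem⟩ with hQ₁
  -- the strict condition: `f(y) ≡ y • Q₁ - Q₁ (mod C_v)` on `H ⊓ D_v`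
  rw [LocalDatum.mem_strictKer_iff]
  unfold LocalDatum.strictMap
  rw [CocycleCriteria.resH1Hom_oneCocycleClass_eq_zero_iff]
  refine ⟨N.grMk Q₁, fun y ↦ ?_⟩
  -- `y ∈ H ⊓ D_v` is the restriction of some `τ ∈ H_{K_v}`
  obtain ⟨τ, hτ⟩ := (y : decomp (K := K) v).2
  have hτ' : absGaloisRestrict K Kv τ = ((y : decomp (K := K) v) : absoluteGaloisGroup K) := hτ
  have hτH : τ ∈ localSubgroup H Kv := by
    rw [mem_localSubgroup_iff]
    change absGaloisRestrict K Kv τ ∈ H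
    rw [hτ']
    exact (mem_decompIn_iff H v y).1 y.2
  have hres : resGalSubgroup H Kv ⟨τ, hτH⟩ = decompInToH H v y := Subtype.ext hτ'
  have key := hP ⟨τ, hτH⟩
  change pointsMapOfEmb W (closureEmb (K := K) Kv) ((f.1 (resGalSubgroup H Kv ⟨τ, hτH⟩) : W.geomPoints)) =
    τ • P - P at key
  rw [hres] at key
  -- reduce to membership in `C_v`, i.e. `pointsMap (f y - (y • Q₁ - Q₁)) ∈ E₁`
  rw [Subgroup.smul_def, LocalDatum.smul_grMk, ← map_sub, ← sub_eq_zero, ← map_sub, ← AddMonoidHom.mem_ker,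
    LocalDatum.ker_grMk, hN, WeierstrassCurve.mem_kernelOfReductionLocalDatum_plus_iff]
  have hsmul : pointsMap W Kv
      (((((y : decomp (K := K) v) : absoluteGaloisGroup K) • Q₁ : W.geomPrimaryTorsion p) : W.geomPoints)) = τ • q₀ := by
    rw [primaryComponent.coe_smul, ← hτ']
    change pointsMap W Kv (resGal (K := K) Kv τ • Q₀) = τ • q₀
    rw [pointsMap_smul, ← hQ₀]
    rfl
  have hQ₁pt : pointsMap W Kv ((Q₁ : W.geomPrimaryTorsion p) : W.geomPoints) = q₀ := by
    rw [← hQ₀]; rfl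
  rw [AddSubgroupClass.coe_sub, AddSubgroupClass.coe_sub, map_sub, map_sub, hsmul, hQ₁pt]
  change pointsMapOfEmb W (closureEmb (K := K) Kv) _ - (τ • q₀ - q₀) ∈ E₁
  rw [key]
  -- `(τP - P) - (τ q₀ - q₀) = (τ P' - P') + (τ Z - Z)`
  have halg : τ • P - P - (τ • q₀ - q₀) = (τ • P' - P') + (τ • Z - Z) := by
    rw [hsplit, hq₀, smul_add, smul_sub]; abel
  rw [halg]
  refine E₁.add_mem ?_ (E₁.sub_mem ((W.smul_mem_localKernelOfReduction_iff v τ Z).mpr hZ) hZ)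
  -- `τ P' - P' ∈ E₁`: killed by `p^k` (the cocycle is `p`-primary) and by `u` modulo `E₁`
  obtain ⟨k, hk⟩ := (AddCommGroup.mem_primaryComponent).mp (f.1 (decompInToH H v y)).2
  have hkP : p ^ k • (τ • P - P) = 0 := by
    rw [← key, ← map_nsmul, hk, map_zero]
  have hkP' : p ^ k • (τ • P' - P') = 0 := by
    have h : τ • P' - P' = (α * (p ^ c₀ : ℕ) : ℤ) • (τ • P - P) := by
      rw [hP', smul_sub, smul_comm τ]
    rw [h, smul_comm, hkP, smul_zero]
  have huP'τ : u • (τ • P' - P') ∈ E₁ := by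
    rw [smul_sub, smul_comm]
    exact E₁.sub_mem ((W.smul_mem_localKernelOfReduction_iff v τ _).mpr huP') huP'
  exact mem_of_pow_nsmul_eq_zero_of_nsmul_mem E₁ (hcop.pow_left k) hkP' huP'τ

/-- **Kummer ⇒ strict for the canonical datum, `HasUnitRootAt` form** (the binders of the cite-only record
`Greenberg1999.imKummer_eq_strictCondition_goodOrdinary_numberField`: `hpv`, `hgood`, `hord : W.HasUnitRootAt v`; its `≤` half,
for every `H`, with no `κ` / `hram` / closedness / finite-index binder). [cite: GreenbergLNM1716, §2 Prop. 2.2 (i), Prop. 2.4] -/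
theorem localKerOver_le_strictKer_kernelOfReduction [W.IsElliptic]
    (hpv : (p : 𝓞 K) ∈ v.asIdeal) (hgood : W.HasGoodReductionAt v) (hord : W.HasUnitRootAt v) :
    W.localKerOver p H (v.adicCompletion K) ≤ (W.kernelOfReductionLocalDatum p v).strictKer H := by
  refine W.localKerOver_le_strictKer_kernelOfReduction_of_not_dvd v p H hpv hgood ?_
  have h := (W.hasUnitRootAt_iff (v := v)).mp hord
  rw [WeierstrassCurve.ringChar_residueField_eq v hp.out hpv] at h
  unfold WeierstrassCurve.frobeniusTraceAt
  exact h

/-! ## §4 At the layer `K_∞` of a `ℤ_p`-extension (`H = ker κ`) — the shape the cell's consumers read -/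

/-- **At `H = ker κ`**: `localKerOver p (ker κ) K_v ≤ (kernelOfReductionLocalDatum p v).strictKer (ker κ)` — the `.le` of
`Greenberg1999.imKummer_eq_strictCondition_goodOrdinary_numberField.kerSubgroup_kernelOfReduction`, now a theorem for EVERY
`ℤ_p`-extension `κ` (no `hram`). [cite: GreenbergLNM1716, §2 Prop. 2.2 (i), Prop. 2.4 (pp. 73–80)] -/
theorem localKerOver_kerSubgroup_le_strictKer_kernelOfReduction [W.IsElliptic] (κ : ZpExtension K p)
    (hpv : (p : 𝓞 K) ∈ v.asIdeal) (hgood : W.HasGoodReductionAt v) (hord : W.HasUnitRootAt v) :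
    W.localKerOver p κ.kerSubgroup (v.adicCompletion K) ≤
      (W.kernelOfReductionLocalDatum p v).strictKer κ.kerSubgroup :=
  W.localKerOver_le_strictKer_kernelOfReduction v p κ.kerSubgroup hpv hgood hord

/-- **The equation `localKerOver = strictKer` from its hard half.**  Granted `Im λ ⊆ Im κ` at `H` (`h`, the Tate /
Coates–Greenberg direction, to be supplied on the frames where it is a theorem), the printed EQUALITY of Greenberg's Prop. 2.4
holds at `H` for the canonical datum. [cite: GreenbergLNM1716, §2 Prop. 2.4 (pp. 79–80)] -/
theorem localKerOver_eq_strictKer_kernelOfReduction_of_ge [W.IsElliptic]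
    (hpv : (p : 𝓞 K) ∈ v.asIdeal) (hgood : W.HasGoodReductionAt v) (hord : W.HasUnitRootAt v)
    (h : (W.kernelOfReductionLocalDatum p v).strictKer H ≤ W.localKerOver p H (v.adicCompletion K)) :
    W.localKerOver p H (v.adicCompletion K) = (W.kernelOfReductionLocalDatum p v).strictKer H :=
  le_antisymm (W.localKerOver_le_strictKer_kernelOfReduction v p H hpv hgood hord) h

end WeierstrassCurve

end
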